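import Summits.HubbardSuperconductivity.HubbardSuperconductivity.Theorems.DeformationLadderLowEnergyRigidityInheritance
import Summits.HubbardSuperconductivity.HubbardSuperconductivity.Theorems.DeformationLadderLadderThesisRigidityReduction
import Summits.HubbardSuperconductivity.HubbardSuperconductivity.Theorems.DeformationLadderLowEnergyRigidityTelescopeNormalForms

/-!
# Route `DeformationLadder`, crux `LowEnergyRigidity` (item `stmt-HubbardSuperconductivity-1892`):
# the block-penalised model `H_L + c·𝓜_R` — sector structure, ground states, a priori bounds

Companion of `DeformationLadderLowEnergyRigidityInheritance` (`--supports stmt-HubbardSuperconductivity-1892`):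
finite-dimensional bookkeeping for the mesoscopic pair-order operator `𝓜_R = mesoOp L R` of the
inheritance cut, consumed by the normal forms of `DeformationLadderLowEnergyRigidityCutNormalForms`.

* `exists_unit_mem_szSector` — the crux's sectors `szSector (2⌊(1-δ)L²/2⌋) 0` contain unit vectors
  (`-1 ≤ δ`), so Mathlib's `sInf` in `minEnergyOn` is never junk there;
* `shifts_blockPair`, `preservesSectors_mesoOp`, `preservesSectors_mesoPenalised`,
  `isHermitian_mesoPenalised` — `B_R(x)` has `(N↑,N↓)`-grade `(-1,-1)`, so `𝓜_R` and `H_L + c·𝓜_R`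
  conserve `N↑, N↓`; the penalised matrix is Hermitian for real `c`;
* `sector_groundState_of_preservesSectors` (any Hermitian sector-preserving matrix on the Hubbard
  torus), `exists_unit_groundState_mesoPenalised` — normalised sector ground states of `H_L + c·𝓜_R`
  exist;
* `norm_blockPair_le` (`‖B_R(x)‖ ≤ 4√2R²`), `re_expect_mesoOp_le` (`Re⟨𝓜_R⟩ ≤ 32L²R⁴` on unit
  vectors), `mesoDensity_le` (block pair-order density `≤ 32`), `minEnergyOn_mesoPenalised_le`
  (the penalty `(τ/R⁴)𝓜_R` raises the sector energy by at most `32τL²`).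

Same pattern as for the `q = 0` penalty `Δ_dᴴΔ_d` in `DeformationLadderLadderThesisRigidityReduction`
(Lieb, PRL 62 (1989) 1201, sector argument; Tasaki (2020) §2.2; Scalapino (1995) §2 for the pair
operators). Folklore; no definition is introduced.
-/

noncomputable section

namespace Summit.HubbardSuperconductivity.HubbardSuperconductivity.Theorems.LowEnergyRigidity

set_option linter.dupNamespace false -- summit = problem name (single-conjunct summit), D-0017

open Matrix
open scoped Matrix.Norms.L2Operator ComplexOrder
open Literature.MathematicalPhysics.QuantumLattice Literature.Probability.LatticeModels
open Summit.HubbardSuperconductivity.HubbardSuperconductivity.Theses.DeformationLadder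
open Summit.HubbardSuperconductivity.HubbardSuperconductivity.Theorems
  (minEnergyOn_le_re_rayleigh bddBelow_rayleighSet)

/-! ### The crux's sectors are non-empty -/

/-- The crux's sectors are non-empty: for `-1 ≤ δ` there is a unit vector in
`szSector (2⌊(1-δ)L²/2⌋) 0` (a normalised sector ground state of the pure model exists,
`exists_unit_groundStateInSector_hubbardTorus` with `⌊(1-δ)L²/2⌋ ≤ L²`). [folklore] -/
theorem exists_unit_mem_szSector (L : ℕ) [NeZero L] (U δ : ℝ) (hδ : -1 ≤ δ) :
    ∃ ψ ∈ szSector (Λ := FermionTorus 2 L) (2 * ⌊(1 - δ) * (L : ℝ) ^ 2 / 2⌋₊) 0,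
      star ψ ⬝ᵥ ψ = 1 := by
  obtain ⟨ψ, hψ1, hψ⟩ :=
    Summit.HubbardSuperconductivity.NoGo.exists_unit_groundStateInSector_hubbardTorus L 1 U
      (Summit.HubbardSuperconductivity.NoGo.floor_pairNumber_le δ hδ L)
  exact ⟨ψ, hψ.1, hψ1⟩

/-! ### Sector structure, ground states and a priori bounds of the block-penalised model -/

section MesoPenalised

variable (L : ℕ) [NeZero L] (R : ℕ)

/-- `B_R(x)` has `(N↑, N↓)`-grade `(-1,-1)` (a sum of local singlet pair annihilators). [folklore] -/
theorem shifts_blockPair (x : TorusSite 2 L) : PairChirality.Shifts (-1) (-1) (blockPair L R x) :=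
  PairChirality.Shifts.sum fun _ _ => PairChirality.shifts_localPair L dWaveFormFactor _

/-- `𝓜_R` conserves `N↑` and `N↓`. [folklore] -/
theorem preservesSectors_mesoOp : PreservesSectors (mesoOp L R) := by
  have h : PairChirality.Shifts 0 0 (mesoOp L R) := by
    unfold mesoOp
    refine PairChirality.Shifts.sum fun x _ => ?_
    have h := (shifts_blockPair L R x).conjTranspose.mul (shifts_blockPair L R x)
    simp only [Int.reduceNeg, neg_neg, add_neg_cancel] at h
    exact h
  exact h.preservesSectors

/-- The block-penalised Hamiltonian `H_L + c·𝓜_R` conserves `N↑` and `N↓`. [folklore] -/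
theorem preservesSectors_mesoPenalised (U : ℝ) (c : ℂ) :
    PreservesSectors (hubbardTorus 2 L 1 U + c • mesoOp L R) :=
  (LiebThm1.preservesSectors_hamiltonian (fermionTorusGraph 2 L) 1 U).add
    ((preservesSectors_mesoOp L R).smul c)

/-- The block-penalised Hamiltonian `H_L + c·𝓜_R` is Hermitian for real `c`. [folklore] -/
theorem isHermitian_mesoPenalised (U c : ℝ) :
    (hubbardTorus 2 L 1 U + ((c : ℝ) : ℂ) • mesoOp L R).IsHermitian := by
  have h := isHermitian_hubbardTorusWith L 1 U 0
  rw [hubbardTorusWith_zero] at h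
  exact h.add ((posSemidef_mesoOp L R).isHermitian.smul
    (by rw [isSelfAdjoint_iff, Complex.star_def, Complex.conj_ofReal]))

omit [NeZero L] in
/-- **Sector ground states of a sector-preserving Hermitian matrix exist** on the Hubbard torus: for
`n ≤ L²`, a Hermitian `A` conserving `N↑, N↓` has a ground state in the joint sector
`(N, S^z) = (2n, 0)`, whose sector energy bounds every unit Rayleigh quotient of the sector from below
(`sector_groundState` on the coordinate subspace `szSector (2n) 0`; the sector is non-empty because
`n ≤ L² = |Λ_L|`). Lieb, PRL 62 (1989) 1201, proof of Thm 1; Tasaki (2020) §2.2. [folklore] -/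
theorem sector_groundState_of_preservesSectors
    (A : Matrix (Finset (Orb (FermionTorus 2 L))) (Finset (Orb (FermionTorus 2 L))) ℂ)
    (hA : A.IsHermitian) (hPS : PreservesSectors A) {n : ℕ} (hn : n ≤ L ^ 2) :
    (∃ ψ, IsGroundStateInSector A (2 * n) 0 ψ) ∧
      ∀ v ∈ szSector (Λ := FermionTorus 2 L) (2 * n) 0, star v ⬝ᵥ v = 1 →
        A.minEnergyOn (szSector (2 * n) 0) ≤ (star v ⬝ᵥ A *ᵥ v).re := by
  classical
  have hcard : n ≤ Fintype.card (FermionTorus 2 L) := by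
    rwa [Summit.HubbardSuperconductivity.NoGo.card_fermionTorus_two]
  obtain ⟨α₀, -, hα₀⟩ : ∃ α₀ : Finset (FermionTorus 2 L), α₀ ⊆ Finset.univ ∧ α₀.card = n :=
    Finset.exists_subset_card_eq (by rwa [Finset.card_univ])
  have hp : ∃ s : Finset (Orb (FermionTorus 2 L)), (upPart s).card = n ∧ (downPart s).card = n :=
    ⟨pairSet α₀ α₀, by rw [upPart_pairSet, hα₀], by rw [downPart_pairSet, hα₀]⟩
  have hinv : ∀ s s' : Finset (Orb (FermionTorus 2 L)),
      ¬((upPart s).card = n ∧ (downPart s).card = n) →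
      ((upPart s').card = n ∧ (downPart s').card = n) → A s s' = 0 := by
    intro s s' hs hs'
    by_contra h
    have := hPS s s' h
    exact hs ⟨this.1.trans hs'.1, this.2.trans hs'.2⟩
  have hK : ∀ v : Fock (Orb (FermionTorus 2 L)), v ∈ szSector (2 * n) (0 : ℝ) ↔
      ∀ s, ¬((upPart s).card = n ∧ (downPart s).card = n) → v s = 0 :=
    fun v => mem_szSector_two_mul_zero_iff n v
  obtain ⟨⟨v, hv, hv0, hAv⟩, hb⟩ := sector_groundState A hA
    (fun s => (upPart s).card = n ∧ (downPart s).card = n) hp hinv (szSector (2 * n) 0) hK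
  exact ⟨⟨v, hv, hv0, hAv⟩, hb⟩

/-- **Normalised sector ground states of the block-penalised model exist**: for real `c` and
`-1 ≤ δ`, `H_L + c·𝓜_R` has a unit-norm ground state in the crux's sector
`szSector (2⌊(1-δ)L²/2⌋) 0`. [folklore] -/
theorem exists_unit_groundState_mesoPenalised (U c δ : ℝ) (hδ : -1 ≤ δ) :
    ∃ φ : Fock (Orb (FermionTorus 2 L)), star φ ⬝ᵥ φ = 1 ∧
      IsGroundStateInSector (hubbardTorus 2 L 1 U + ((c : ℝ) : ℂ) • mesoOp L R)
        (2 * ⌊(1 - δ) * (L : ℝ) ^ 2 / 2⌋₊) 0 φ := by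
  obtain ⟨⟨ψ, hψ⟩, -⟩ := sector_groundState_of_preservesSectors L _
    (isHermitian_mesoPenalised L R U c) (preservesSectors_mesoPenalised L R U _)
    (Summit.HubbardSuperconductivity.NoGo.floor_pairNumber_le δ hδ L)
  obtain ⟨a, ha, ha1⟩ := exists_smul_unit hψ.2.1
  exact ⟨a • ψ, ha1, Summit.HubbardSuperconductivity.NoGo.isGroundStateInSector_smul _ _ _ hψ ha⟩

/-- `‖B_R(x)‖ ≤ 4√2·R²` (`R²` local pairs of norm `≤ 4√2` each). [folklore] -/
theorem norm_blockPair_le (x : TorusSite 2 L) : ‖blockPair L R x‖ ≤ 4 * Real.sqrt 2 * (R : ℝ) ^ 2 := by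
  unfold blockPair
  refine (norm_sum_le _ _).trans ?_
  have hloc : ∀ y : TorusSite 2 L, ‖localPair dWaveFormFactor L y‖ ≤ 4 * Real.sqrt 2 := fun y =>
    (norm_localPair_le dWaveFormFactor L y).trans
      (by have h := sum_abs_dWaveFormFactor_div_sqrt_two_le; linarith)
  calc ∑ a : Fin R × Fin R,
        ‖localPair dWaveFormFactor L (x + Torus.proj L ![((a.1 : ℕ) : ℤ), ((a.2 : ℕ) : ℤ)])‖
      ≤ ∑ _a : Fin R × Fin R, 4 * Real.sqrt 2 := Finset.sum_le_sum fun a _ => hloc _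
    _ = 4 * Real.sqrt 2 * (R : ℝ) ^ 2 := by
        rw [Finset.sum_const, Finset.card_univ, Fintype.card_prod, Fintype.card_fin, nsmul_eq_mul]
        push_cast
        ring

/-- **A priori bound** `Re⟨φ, 𝓜_R φ⟩ ≤ 32·L²·R⁴` for a unit vector `φ`
(`Re⟨φ, B_R(x)ᴴB_R(x) φ⟩ = ‖B_R(x)φ‖² ≤ ‖B_R(x)‖² ≤ 32R⁴`, summed over the `L²` block positions);
so the block pair-order density `Re⟨𝓜_R⟩/(L²R⁴)` and the window weight lie in `[0, 32]`. [folklore] -/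
theorem re_expect_mesoOp_le {φ : Fock (Orb (FermionTorus 2 L))} (hφ : star φ ⬝ᵥ φ = 1) :
    (expect (mesoOp L R) φ).re ≤ 32 * (L : ℝ) ^ 2 * (R : ℝ) ^ 4 := by
  unfold expect mesoOp
  rw [Matrix.sum_mulVec, dotProduct_sum, Complex.re_sum]
  have hsq : Real.sqrt 2 ^ 2 = 2 := Real.sq_sqrt zero_le_two
  have hterm : ∀ x : TorusSite 2 L,
      (star φ ⬝ᵥ ((blockPair L R x)ᴴ * blockPair L R x) *ᵥ φ).re ≤ 32 * (R : ℝ) ^ 4 := by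
    intro x
    rw [← star_mulVec_dotProduct_mulVec, ← eucNorm_sq]
    have h1 : eucNorm (blockPair L R x *ᵥ φ) ≤ 4 * Real.sqrt 2 * (R : ℝ) ^ 2 := by
      have h := eucNorm_mulVec_le (blockPair L R x) φ
      rw [eucNorm_eq_one hφ, mul_one] at h
      exact h.trans (norm_blockPair_le L R x)
    calc eucNorm (blockPair L R x *ᵥ φ) ^ 2
        ≤ (4 * Real.sqrt 2 * (R : ℝ) ^ 2) ^ 2 := pow_le_pow_left₀ (eucNorm_nonneg _) h1 2
      _ = 32 * (R : ℝ) ^ 4 := by rw [mul_pow, mul_pow, hsq]; ring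
  calc ∑ x : TorusSite 2 L, (star φ ⬝ᵥ ((blockPair L R x)ᴴ * blockPair L R x) *ᵥ φ).re
      ≤ ∑ _x : TorusSite 2 L, 32 * (R : ℝ) ^ 4 := Finset.sum_le_sum fun x _ => hterm x
    _ = 32 * (L : ℝ) ^ 2 * (R : ℝ) ^ 4 := by
        rw [Finset.sum_const, Finset.card_univ, Fintype.card_fun, ZMod.card, Fintype.card_fin,
          nsmul_eq_mul]
        push_cast
        ring

/-- The block pair-order density is at most `32`: `Re⟨φ, 𝓜_R φ⟩/(L²R⁴) ≤ 32` for unit `φ`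
(junk-safe: the quotient is `0` for `R = 0`). [folklore] -/
theorem mesoDensity_le {φ : Fock (Orb (FermionTorus 2 L))} (hφ : star φ ⬝ᵥ φ = 1) :
    (expect (mesoOp L R) φ).re / ((L : ℝ) ^ 2 * (R : ℝ) ^ 4) ≤ 32 := by
  rcases Nat.eq_zero_or_pos R with hR | hR
  · subst hR
    simp
  have hpos : (0 : ℝ) < (L : ℝ) ^ 2 * (R : ℝ) ^ 4 := by
    have hL : (0 : ℝ) < (L : ℝ) := by exact_mod_cast Nat.pos_of_ne_zero (NeZero.ne L)
    have hR' : (0 : ℝ) < (R : ℝ) := by exact_mod_cast hR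
    positivity
  rw [div_le_iff₀ hpos]
  have h := re_expect_mesoOp_le L R hφ
  linarith

/-- **The block penalty raises the sector energy by at most `32τL²`**: for `τ ≥ 0` and `-1 ≤ δ`,
`minEnergyOn (H_L + (τ/R⁴)𝓜_R) K_L ≤ minEnergyOn H_L K_L + 32 τ L²`. [folklore] -/
theorem minEnergyOn_mesoPenalised_le (U : ℝ) {τ : ℝ} (hτ : 0 ≤ τ) (δ : ℝ) (hδ : -1 ≤ δ) :
    (hubbardTorus 2 L 1 U + (((τ / (R : ℝ) ^ 4 : ℝ) : ℂ)) • mesoOp L R).minEnergyOn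
        (szSector (Λ := FermionTorus 2 L) (2 * ⌊(1 - δ) * (L : ℝ) ^ 2 / 2⌋₊) 0) ≤
      (hubbardTorus 2 L 1 U).minEnergyOn
          (szSector (Λ := FermionTorus 2 L) (2 * ⌊(1 - δ) * (L : ℝ) ^ 2 / 2⌋₊) 0) +
        32 * τ * (L : ℝ) ^ 2 := by
  rw [← sub_le_iff_le_add]
  refine Telescope.le_minEnergyOn_of_forall_unit _ _ (exists_unit_mem_szSector L U δ hδ) fun ψ hψK hψ1 => ?_
  have h1 := minEnergyOn_le_re_rayleigh
    (hubbardTorus 2 L 1 U + (((τ / (R : ℝ) ^ 4 : ℝ) : ℂ)) • mesoOp L R) _ hψK hψ1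
  rw [add_mulVec, dotProduct_add, Complex.add_re, re_expect_penalisedMeso] at h1
  have h2 : τ * (L : ℝ) ^ 2 * ((expect (mesoOp L R) ψ).re / ((L : ℝ) ^ 2 * (R : ℝ) ^ 4)) ≤
      τ * (L : ℝ) ^ 2 * 32 := mul_le_mul_of_nonneg_left (mesoDensity_le L R hψ1) (by positivity)
  linarith

end MesoPenalised

end Summit.HubbardSuperconductivity.HubbardSuperconductivity.Theorems.LowEnergyRigidity
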